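import Mathlib.MeasureTheory.Constructions.HaarToSphere
import Mathlib.MeasureTheory.Measure.Haar.InnerProductSpace
import Mathlib.Analysis.SpecialFunctions.Integrals.Basic
import HarnessLib

/-!
# Second moments of Euclidean balls

Topic: Analysis/FluidPDE (support file for the matrix-kernel averages of
`Literature.Analysis.FluidPDE.NovackLongitudinalBalance`: the masses
`⨍_{B_ℓ} [(1 − |y|²/ℓ²) 1 + y⊗y/ℓ²] dy = (3/(d+2)) 1` and
`⨍_{B_ℓ} [1 − ((d−1)/2)(1 − |y|²/ℓ²)] dy = 3/(d+2)` of Novack 2024, §2 Step 2, (claim), rest on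
the second moments of the ball). All proved:

* `integral_ball_norm_sq` — `∫_{B_r} |y|² dy = (d/(d+2)) |B_1| r^{d+2}` (polar coordinates,
  Mathlib's `integral_fun_norm_addHaar`);
* `integral_ball_apply_mul_apply_of_ne` — `∫_{B_r} yᵢ yⱼ dy = 0` for `i ≠ j` (the coordinate
  reflection `yᵢ ↦ −yᵢ`, a volume-preserving linear isometry of the ball, built in-proof from
  `LinearIsometryEquiv.piLpCongrRight`);
* `integral_ball_apply_sq` — `∫_{B_r} yᵢ² dy = (1/(d+2)) |B_1| r^{d+2}` (coordinate permutations
  are volume-preserving isometries, and `∑ᵢ yᵢ² = |y|²`).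

## References

* G. B. Folland, *Real Analysis*, 2nd ed. (1999), §2.7 (integration in polar coordinates),
  Cor. 2.51 and Exercise 2.62–2.63 (moments of the ball). [Folland1999]
-/

noncomputable section

open MeasureTheory TopologicalSpace Set Function Filter Metric Module
open scoped ENNReal NNReal

namespace Literature.Analysis.FluidPDE

variable {d : Type*} [Fintype d]

/-- **Polar-coordinate computation of `∫_{B_r} |y|²`**: `∫_{|y| < r} |y|² dy = (d/(d+2)) |B(0,1)| r^{d+2}`
in `ℝ^d` (`d ≥ 1`, `r ≥ 0`). [cite: Folland1999, Cor. 2.51] -/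
theorem integral_ball_norm_sq [Nonempty d] {r : ℝ} (hr : 0 ≤ r) :
    ∫ y in ball (0 : EuclideanSpace ℝ d) r, ‖y‖ ^ 2 =
      (Fintype.card d : ℝ) / (Fintype.card d + 2) *
        (volume (ball (0 : EuclideanSpace ℝ d) 1)).toReal * r ^ (Fintype.card d + 2) := by
  set n : ℕ := Fintype.card d with hn
  have hn1 : 1 ≤ n := Fintype.card_pos
  have hind : (ball (0 : EuclideanSpace ℝ d) r).indicator (fun y : EuclideanSpace ℝ d => ‖y‖ ^ 2) =
      fun y : EuclideanSpace ℝ d => (Iio r).indicator (fun s : ℝ => s ^ 2) ‖y‖ := by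
    funext y
    by_cases hy : ‖y‖ < r
    · simp [indicator, hy]
    · simp [indicator, hy]
  rw [← integral_indicator measurableSet_ball, hind,
    integral_fun_norm_addHaar (volume : Measure (EuclideanSpace ℝ d))
      (fun s : ℝ => (Iio r).indicator (fun s : ℝ => s ^ 2) s), finrank_euclideanSpace]
  have hinner : ∫ s in Ioi (0 : ℝ), s ^ (n - 1) • (Iio r).indicator (fun s : ℝ => s ^ 2) s =
      r ^ (n + 2) / (n + 2) := by
    have h1 : EqOn (fun s : ℝ => s ^ (n - 1) • (Iio r).indicator (fun s : ℝ => s ^ 2) s)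
        ((Iio r).indicator fun s : ℝ => s ^ (n + 1)) (Ioi 0) := by
      intro s _
      by_cases hsr : s < r
      · simp only [smul_eq_mul, indicator, mem_Iio, hsr, if_true]
        rw [← pow_add]
        congr 1
        omega
      · simp [indicator, hsr]
    rw [setIntegral_congr_fun measurableSet_Ioi h1, setIntegral_indicator measurableSet_Iio,
      Ioi_inter_Iio, ← integral_Ioc_eq_integral_Ioo, ← intervalIntegral.integral_of_le hr, integral_pow]
    simp only [Nat.cast_add, Nat.cast_one]
    rw [zero_pow (by omega), sub_zero]
    ring_nf
  rw [hinner, measureReal_def]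
  simp only [nsmul_eq_mul, smul_eq_mul]
  have hn2 : (n : ℝ) + 2 ≠ 0 := by positivity
  rw [← hn]
  field_simp

/-- **Off-diagonal second moments of the ball vanish**: `∫_{|y| < r} yᵢ yⱼ dy = 0` for `i ≠ j`
(the reflection `yᵢ ↦ −yᵢ` preserves the ball and Lebesgue measure and flips the sign of the
integrand). [cite: Folland1999, Exercise 2.63] -/
theorem integral_ball_apply_mul_apply_of_ne [DecidableEq d] {i j : d} (hij : i ≠ j) (r : ℝ) :
    ∫ y in ball (0 : EuclideanSpace ℝ d) r, y i * y j = 0 := by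
  -- the coordinate reflection `yᵢ ↦ −yᵢ`, a linear isometry of `ℝ^d`
  set R : EuclideanSpace ℝ d ≃ₗᵢ[ℝ] EuclideanSpace ℝ d := LinearIsometryEquiv.piLpCongrRight 2
    fun k => if k = i then LinearIsometryEquiv.neg ℝ else LinearIsometryEquiv.refl ℝ ℝ with hR
  have hRapply : ∀ (y : EuclideanSpace ℝ d) (k : d), R y k = if k = i then -y k else y k := by
    intro y k
    rw [hR, LinearIsometryEquiv.piLpCongrRight_apply]
    by_cases hk : k = i
    · subst hk
      simp
    · simp [hk]
  have hmp : MeasurePreserving R volume volume := R.measurePreserving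
  have hemb : MeasurableEmbedding R := R.toHomeomorph.measurableEmbedding
  have hpre : R ⁻¹' ball (0 : EuclideanSpace ℝ d) r = ball 0 r := by
    ext y
    simp
  have h := hmp.setIntegral_preimage_emb hemb (fun y : EuclideanSpace ℝ d => y i * y j) (ball 0 r)
  rw [hpre] at h
  have hflip : ∀ y : EuclideanSpace ℝ d, R y i * R y j = -(y i * y j) := fun y => by
    rw [hRapply, hRapply, if_pos rfl, if_neg (Ne.symm hij)]
    ring
  simp only [hflip, integral_neg] at h
  linarith

/-- Second moments of the ball are integrable (continuous integrand, bounded set). [folklore] -/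
theorem integrableOn_ball_apply_sq (i : d) (r : ℝ) :
    IntegrableOn (fun y : EuclideanSpace ℝ d => y i ^ 2) (ball 0 r) volume :=
  (((continuous_apply i |>.comp (PiLp.continuous_ofLp 2 _)).pow 2).continuousOn.integrableOn_compact
      (isCompact_closedBall (0 : EuclideanSpace ℝ d) r)).mono_set ball_subset_closedBall

/-- **Diagonal second moments of the ball**: `∫_{|y| < r} yᵢ² dy = (1/(d+2)) |B(0,1)| r^{d+2}`
(all diagonal moments agree by permutation symmetry and sum to `∫ |y|²`). [cite: Folland1999, Exercise 2.63] -/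
theorem integral_ball_apply_sq [DecidableEq d] [Nonempty d] (i : d) {r : ℝ} (hr : 0 ≤ r) :
    ∫ y in ball (0 : EuclideanSpace ℝ d) r, y i ^ 2 =
      1 / ((Fintype.card d : ℝ) + 2) *
        (volume (ball (0 : EuclideanSpace ℝ d) 1)).toReal * r ^ (Fintype.card d + 2) := by
  -- all diagonal moments agree
  have hswap : ∀ j : d, ∫ y in ball (0 : EuclideanSpace ℝ d) r, y j ^ 2 =
      ∫ y in ball (0 : EuclideanSpace ℝ d) r, y i ^ 2 := by
    intro j
    set P := LinearIsometryEquiv.piLpCongrLeft 2 ℝ ℝ (Equiv.swap i j) with hP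
    have hmp : MeasurePreserving P volume volume := P.measurePreserving
    have hemb : MeasurableEmbedding P := P.toHomeomorph.measurableEmbedding
    have hpre : P ⁻¹' ball (0 : EuclideanSpace ℝ d) r = ball 0 r := by
      ext y
      simp [hP]
    have h := hmp.setIntegral_preimage_emb hemb (fun y : EuclideanSpace ℝ d => y i ^ 2) (ball 0 r)
    rw [hpre] at h
    have hP' : ∀ y : EuclideanSpace ℝ d, P y i = y j := fun y => by
      rw [hP, LinearIsometryEquiv.piLpCongrLeft_apply, Equiv.piCongrLeft'_apply,
        Equiv.symm_swap, Equiv.swap_apply_left]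
    simp only [hP'] at h
    exact h
  -- and they sum to `∫ |y|²`
  have hsum : ∫ y in ball (0 : EuclideanSpace ℝ d) r, ‖y‖ ^ 2 =
      ∑ j : d, ∫ y in ball (0 : EuclideanSpace ℝ d) r, y j ^ 2 := by
    rw [← integral_finsetSum Finset.univ fun j _ => integrableOn_ball_apply_sq j r]
    refine integral_congr_ae (ae_of_all _ fun y => ?_)
    exact EuclideanSpace.real_norm_sq_eq y
  simp only [hswap, Finset.sum_const, Finset.card_univ, nsmul_eq_mul] at hsum
  rw [integral_ball_norm_sq hr] at hsum
  have hd0 : (Fintype.card d : ℝ) ≠ 0 := by exact_mod_cast Fintype.card_ne_zero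
  have hd2 : (Fintype.card d : ℝ) + 2 ≠ 0 := by positivity
  field_simp at hsum ⊢
  linarith [hsum]

end Literature.Analysis.FluidPDE
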